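import Summits.CriticalPhenomena.PercolationContinuityZ3.Theorems.PercNearOneGluingNoHeavyLowerTailSteinerBlobMeasure
import Summits.CriticalPhenomena.PercolationContinuityZ3.Theorems.PercNearOneGluingNoHeavyLowerTailOneLayerFullGraphChampion
import Summits.CriticalPhenomena.PercolationContinuityZ3.Theorems.PercNearOneGluingNoHeavyLowerTailCILConstReduction
import HarnessLib

/-!
# `NoHeavyLowerTail` (stmt-CriticalPhenomena-4575) — the PORT-SELECTION lemma and the typed target
# `noHeavyLowerTail_of_portSelection`

Lemma factory #6 (`prim-lf-6`, gen 4), 2026-08-19; candidate B4.1 of `run/shared/lean/prim/prim-lf-6/CANDIDATES.md` (= the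
LEVEL form of the lead's selection inequality (SEL), LEAD-GEN5 §4b), built on `…SteinerBlobContraction` / `…SteinerBlobMeasure`.

* `SteinerBlob.lowerTail_inter_blob_le` — per blob `V₀ ∋ o`: for every relay `c` at least as fragile AVOIDING `V₀` as every
  relay adjacent to the blob, `μ({1 ≤ N_o ≤ j} ∩ Blob(V₀)) ≤ μ({N_o ≥ 1} ∩ {|π(c)| ≤ j} ∩ Blob(V₀))` (Kozma–Nitzan's Theorem 8
  for the one-layer observer of the blob-weight graph, `LossyStar.lowerTail_le_add`, transported by part II);
* `SteinerBlob.lowerTail_le_sum_selection` — summed over the partition: for every valid selection `c(·)`,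
  `μ{1 ≤ N_o ≤ j} ≤ Σ_{V₀} μ({N_o ≥ 1} ∩ {|π(c(V₀))| ≤ j} ∩ Blob(V₀))` = `μ(o ↔ A ∧ c(W₀) light)`;
* `noHeavyLowerTail_of_portSelection` — the TYPED TARGET: a k-uniform constant `C` with
  `Σ_{V₀} μ(o ↔ A ∧ c(V₀) light ∧ Blob(V₀)) ≤ C · max_a μ(|π(a)| ≤ j)` for some valid selection closes the crux
  (constants are free, `noHeavyLowerTail_of_cumulativeIsolationConst_allLevels`).  Census of the candidate (C = 2 conjectured
  sharp; local sup 1.94, never > 2): ttrl2 request `lf6-port-selection-PI`, kit j063730.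
No definitions, no sorries.
-/

namespace Summit.CriticalPhenomena.PercolationContinuityZ3.Theorems

open MeasureTheory Set Literature.Probability.LatticeModels Literature.Probability.Percolation
open Literature.Probability.Percolation.BlockExploration
open Literature.Probability.Percolation.KNPreFKG
open scoped Classical BigOperators

namespace SteinerBlob

variable {n : ℕ}

/-! ### The port-selection lemma and the typed target -/

/-- **Per-class selection inequality.**  For a blob `V₀ ∋ o` disjoint from `A` and a relay `c ∈ A` that is at least
as fragile AVOIDING `V₀` as every relay adjacent to the blob (Kozma–Nitzan's criterion read on the contraction):
`μ({1 ≤ N_o ≤ j} ∩ Blob(V₀)) ≤ μ({N_o ≥ 1} ∩ {|π(c)| ≤ j} ∩ Blob(V₀))`.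
Proof: independence of `Blob(V₀)` from the contraction, `Ψ_*μ_w = μ_{w̃}`, and Kozma–Nitzan's Theorem 8 for the one-layer
observer `o` of the blob-weight graph (`LossyStar.lowerTail_le_add` with zero slack on the stars containing a port).
[cite: KozmaNitzan2024, Thm. 8 (p. 32) / Lemma 5 (p. 13) — via `LossyStar.lowerTail_le_add`; this work] -/
theorem lowerTail_inter_blob_le (w : Sym2 (Fin n) → unitInterval) (A : Finset (Fin n)) (o : Fin n) (j : ℕ)
    (hoA : o ∉ A) {V₀ : Finset (Fin n)} (ho : o ∈ V₀) (hVA : Disjoint V₀ A) {c : Fin n} (hc : c ∈ A)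
    (hoff : ∀ v ∈ A, (∃ u ∈ V₀, w s(u, v) ≠ 0) →
      (prodBernoulli w).real {ω : BondConfig (Fin n) |
          (A.filter fun z => ω ∈ openConnIn ((↑V₀ : Set (Fin n))ᶜ) v z).card ≤ j} ≤
        (prodBernoulli w).real {ω : BondConfig (Fin n) |
          (A.filter fun z => ω ∈ openConnIn ((↑V₀ : Set (Fin n))ᶜ) c z).card ≤ j}) :
    (prodBernoulli w).real ({ω : BondConfig (Fin n) |
        1 ≤ (A.filter fun x => ω ∈ openConn o x).card ∧ (A.filter fun x => ω ∈ openConn o x).card ≤ j} ∩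
      {ω : BondConfig (Fin n) | (∀ u ∈ V₀, ω ∈ openConnIn (↑V₀ : Set (Fin n)) o u) ∧
        ∀ u ∈ V₀, ∀ x, x ∉ V₀ → x ∉ A → s(u, x) ∉ ω}) ≤
    (prodBernoulli w).real ({ω : BondConfig (Fin n) | 1 ≤ (A.filter fun x => ω ∈ openConn o x).card} ∩
      {ω : BondConfig (Fin n) | (A.filter fun x => ω ∈ openConn c x).card ≤ j} ∩
      {ω : BondConfig (Fin n) | (∀ u ∈ V₀, ω ∈ openConnIn (↑V₀ : Set (Fin n)) o u) ∧
        ∀ u ∈ V₀, ∀ x, x ∉ V₀ → x ∉ A → s(u, x) ∉ ω}) := by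
  set μ := prodBernoulli w with hμ
  set Ψ : BondConfig (Fin n) → BondConfig (Fin n) := fun ω =>
    ({e : Sym2 (Fin n) | (e ∈ ω ∧ ∀ v ∈ e, v ∉ V₀) ∨
      ∃ a ∈ A, e = s(o, a) ∧ ∃ u ∈ V₀, s(u, a) ∈ ω} : BondConfig (Fin n)) with hΨ
  set q : Sym2 (Fin n) → unitInterval := fun e =>
    ⟨μ.real {ω : BondConfig (Fin n) | e ∈ Ψ ω}, ⟨measureReal_nonneg, measureReal_le_one⟩⟩ with hq
  set μ' := prodBernoulli q with hμ'
  set Bl : Set (BondConfig (Fin n)) := {ω : BondConfig (Fin n) | (∀ u ∈ V₀, ω ∈ openConnIn (↑V₀ : Set (Fin n)) o u) ∧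
      ∀ u ∈ V₀, ∀ x, x ∉ V₀ → x ∉ A → s(u, x) ∉ ω} with hBl
  have hco : c ≠ o := fun h => hoA (h ▸ hc)
  -- relays are off the blob
  have hAV : ∀ {z}, z ∈ A → z ∉ V₀ := fun hz h => Finset.disjoint_left.1 hVA h hz
  -- on the blob event, `o ↔ z` and `c ↔ z` (relays `z`) are read on the contraction
  have hreach : ∀ ω ∈ Bl, ∀ {x}, (x = o ∨ x ∉ V₀) → ∀ z ∈ A,
      (ω ∈ (openConn x z : Set (BondConfig (Fin n))) ↔ Ψ ω ∈ (openConn x z : Set (BondConfig (Fin n)))) :=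
    fun ω hω x hx z hz => reachable_contract_iff ho hVA hω hx (Or.inr (hAV hz))
  have hfilter : ∀ ω ∈ Bl, ∀ {x}, (x = o ∨ x ∉ V₀) →
      (A.filter fun z => ω ∈ openConn x z) = A.filter fun z => Ψ ω ∈ openConn x z :=
    fun ω hω x hx => Finset.filter_congr fun z hz => hreach ω hω hx z hz
  -- Step 1: the left side through the contraction
  set L' : Set (BondConfig (Fin n)) := {η : BondConfig (Fin n) |
      1 ≤ (A.filter fun x => η ∈ openConn o x).card ∧ (A.filter fun x => η ∈ openConn o x).card ≤ j} with hL'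
  have e1 : ({ω : BondConfig (Fin n) |
        1 ≤ (A.filter fun x => ω ∈ openConn o x).card ∧ (A.filter fun x => ω ∈ openConn o x).card ≤ j} ∩ Bl) =
      Bl ∩ Ψ ⁻¹' L' := by
    ext ω
    simp only [mem_inter_iff, mem_preimage, hL', mem_setOf_eq]
    constructor
    · rintro ⟨h, hω⟩; rw [hfilter ω hω (Or.inl rfl)] at h; exact ⟨hω, h⟩
    · rintro ⟨hω, h⟩; rw [← hfilter ω hω (Or.inl rfl)] at h; exact ⟨h, hω⟩
  -- Step 3: the right side through the contraction
  set R' : Set (BondConfig (Fin n)) := (⋃ a' ∈ A, (openConn o a' : Set (BondConfig (Fin n)))) ∩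
      {η : BondConfig (Fin n) | (A.filter fun x => η ∈ openConn c x).card ≤ j} with hR'
  have e3 : Bl ∩ Ψ ⁻¹' R' ⊆ ({ω : BondConfig (Fin n) | 1 ≤ (A.filter fun x => ω ∈ openConn o x).card} ∩
      {ω : BondConfig (Fin n) | (A.filter fun x => ω ∈ openConn c x).card ≤ j} ∩ Bl) := by
    rintro ω ⟨hω, h⟩
    rw [mem_preimage, hR'] at h
    obtain ⟨h1, h2⟩ := h
    refine ⟨⟨?_, ?_⟩, hω⟩
    · change 1 ≤ (A.filter fun x => ω ∈ openConn o x).card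
      rw [hfilter ω hω (Or.inl rfl), Nat.succ_le_iff, Finset.card_pos]
      simp only [mem_iUnion, exists_prop] at h1
      obtain ⟨a, ha, hoa⟩ := h1
      exact ⟨a, Finset.mem_filter.2 ⟨ha, hoa⟩⟩
    · change (A.filter fun x => ω ∈ openConn c x).card ≤ j
      rw [hfilter ω hω (Or.inr (hAV hc))]; exact h2
  -- Step 2: Kozma–Nitzan's Theorem 8 on the blob-weight graph (one-layer observer `o`)
  have hiso : ∀ u, u ≠ o → u ∉ A → q s(o, u) = 0 := fun u huo huA => blobWeight_eq_zero w ho huo huA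
  set Δ : Finset (Fin n) → ℝ := fun B => if (B = ∅ ∨ ∃ v ∈ B, q s(o, v) ≠ 0) then 0 else 1 with hΔ
  have hΔ0 : ∀ B, 0 ≤ Δ B := by intro B; simp only [hΔ]; split_ifs <;> norm_num
  have hΔhyp : ∀ B ⊆ A, B.Nonempty → ∃ v ∈ B,
      μ'.real {η : BondConfig (Fin n) | (A.filter fun x => η ∈ openConnIn (({o} : Set (Fin n))ᶜ) v x).card ≤ j} ≤
        μ'.real {η : BondConfig (Fin n) | (A.filter fun x => η ∈ openConnIn (({o} : Set (Fin n))ᶜ) c x).card ≤ j} +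
          Δ B := by
    intro B hBA hBne
    by_cases hport : ∃ v ∈ B, q s(o, v) ≠ 0
    · obtain ⟨v, hvB, hv⟩ := hport
      have hvA : v ∈ A := hBA hvB
      have hΔB : Δ B = 0 := by simp only [hΔ]; rw [if_pos (Or.inr ⟨v, hvB, hv⟩)]
      refine ⟨v, hvB, ?_⟩
      rw [hΔB, add_zero, hμ', blobWeight_real_smallOff_eq w ho hVA j (hAV hvA),
        blobWeight_real_smallOff_eq w ho hVA j (hAV hc)]
      exact hoff v hvA (exists_weight_ne_zero_of_blobWeight_ne_zero w ho hVA hvA hv)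
    · obtain ⟨v, hvB⟩ := hBne
      have hΔB : Δ B = 1 := by
        simp only [hΔ]; rw [if_neg]; push Not; exact ⟨⟨v, hvB⟩, fun v hv => by
          by_contra h; exact hport ⟨v, hv, h⟩⟩
      refine ⟨v, hvB, ?_⟩
      rw [hΔB]
      linarith [measureReal_le_one (μ := μ') (s := {η : BondConfig (Fin n) |
          (A.filter fun x => η ∈ openConnIn (({o} : Set (Fin n))ᶜ) v x).card ≤ j}),
        measureReal_nonneg (μ := μ') (s := {η : BondConfig (Fin n) |
          (A.filter fun x => η ∈ openConnIn (({o} : Set (Fin n))ᶜ) c x).card ≤ j})]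
  have hsum0 : ∑ B ∈ A.powerset, Δ B * μ'.real (starEvent o ↑B) = 0 := by
    refine Finset.sum_eq_zero fun B hB => ?_
    by_cases h : (B = ∅ ∨ ∃ v ∈ B, q s(o, v) ≠ 0)
    · simp only [hΔ]; rw [if_pos h, zero_mul]
    · push Not at h
      obtain ⟨hBne, hnoport⟩ := h
      obtain ⟨v, hvB⟩ := hBne
      have hvo : v ≠ o := fun h' => hoA (h' ▸ Finset.mem_powerset.1 hB hvB)
      rw [hμ', OneLayerFull.real_starEvent_eq_zero_of_weight_zero q o v ↑B (Finset.mem_coe.2 hvB) hvo (hnoport v hvB),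
        mul_zero]
  have thm8 := LossyStar.lowerTail_le_add q A o c j hoA hco hiso Δ hΔ0 hΔhyp
  rw [hsum0, add_zero] at thm8
  change μ'.real L' ≤ μ'.real R' at thm8
  -- assemble
  calc μ.real ({ω : BondConfig (Fin n) |
          1 ≤ (A.filter fun x => ω ∈ openConn o x).card ∧ (A.filter fun x => ω ∈ openConn o x).card ≤ j} ∩ Bl)
      = μ.real (Bl ∩ Ψ ⁻¹' L') := by rw [e1]
    _ = μ.real Bl * μ.real (Ψ ⁻¹' L') := measureReal_blob_inter_preimage_contract w hVA L'
    _ = μ.real Bl * μ'.real L' := by rw [measureReal_preimage_contract w hVA L']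
    _ ≤ μ.real Bl * μ'.real R' := mul_le_mul_of_nonneg_left thm8 measureReal_nonneg
    _ = μ.real Bl * μ.real (Ψ ⁻¹' R') := by rw [measureReal_preimage_contract w hVA R']
    _ = μ.real (Bl ∩ Ψ ⁻¹' R') := (measureReal_blob_inter_preimage_contract w hVA R').symm
    _ ≤ _ := measureReal_mono e3 (measure_ne_top _ _)

/-- **The port-selection lemma.**  For every selection `c` assigning to each blob `V₀ ∋ o` disjoint from `A` a relay that
is at least as fragile avoiding `V₀` as every relay adjacent to the blob:
`μ{1 ≤ N_o ≤ j} ≤ Σ_{V₀} μ({N_o ≥ 1} ∩ {|π(c(V₀))| ≤ j} ∩ Blob(V₀))` ( = `μ(o ↔ A ∧ c(W₀) is light)`, `W₀` the relay-free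
cluster of `o`). [this work] -/
theorem lowerTail_le_sum_selection (w : Sym2 (Fin n) → unitInterval) (A : Finset (Fin n)) (o : Fin n) (j : ℕ)
    (hoA : o ∉ A) (c : Finset (Fin n) → Fin n)
    (hc : ∀ V₀ : Finset (Fin n), o ∈ V₀ → Disjoint V₀ A → c V₀ ∈ A ∧
      ∀ v ∈ A, (∃ u ∈ V₀, w s(u, v) ≠ 0) →
        (prodBernoulli w).real {ω : BondConfig (Fin n) |
            (A.filter fun z => ω ∈ openConnIn ((↑V₀ : Set (Fin n))ᶜ) v z).card ≤ j} ≤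
          (prodBernoulli w).real {ω : BondConfig (Fin n) |
            (A.filter fun z => ω ∈ openConnIn ((↑V₀ : Set (Fin n))ᶜ) (c V₀) z).card ≤ j}) :
    (prodBernoulli w).real {ω : BondConfig (Fin n) |
        1 ≤ (A.filter fun x => ω ∈ openConn o x).card ∧ (A.filter fun x => ω ∈ openConn o x).card ≤ j} ≤
      ∑ V₀ ∈ (Finset.univ : Finset (Finset (Fin n))).filter (fun V₀ => o ∈ V₀ ∧ Disjoint V₀ A),
        (prodBernoulli w).real ({ω : BondConfig (Fin n) | 1 ≤ (A.filter fun x => ω ∈ openConn o x).card} ∩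
          {ω : BondConfig (Fin n) | (A.filter fun x => ω ∈ openConn (c V₀) x).card ≤ j} ∩
          {ω : BondConfig (Fin n) | (∀ u ∈ V₀, ω ∈ openConnIn (↑V₀ : Set (Fin n)) o u) ∧
            ∀ u ∈ V₀, ∀ x, x ∉ V₀ → x ∉ A → s(u, x) ∉ ω}) := by
  rw [← sum_measureReal_inter_blob w A o hoA]
  refine Finset.sum_le_sum fun V₀ hV₀ => ?_
  obtain ⟨ho, hVA⟩ := (Finset.mem_filter.1 hV₀).2
  obtain ⟨hcA, hoff⟩ := hc V₀ ho hVA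
  exact lowerTail_inter_blob_le w A o j hoA ho hVA hcA hoff

end SteinerBlob

open SteinerBlob in
/-- **The port-selection bound closes the crux** (lemma factory #6, candidate B4.1 / the lead's (SEL), typed).  If for
some constant `C ≥ 0`, on every finite weighted graph, for every nonempty relay set `A`, observer `o ∉ A` and level `j`
there are a selection `c` — assigning to every blob `V₀ ∋ o` disjoint from `A` a relay at least as fragile AVOIDING `V₀` as
every relay adjacent to the blob (e.g. the Kozma–Nitzan witness: the most fragile such relay) — and a relay `a ∈ A` with
`Σ_{V₀} μ(o ↔ A ∧ |π(c(V₀))| ≤ j ∧ Blob(V₀)) ≤ C · μ(|π(a)| ≤ j)` ("the relay selected by the observer's relay-free cluster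
is light while the observer is attached" is at most `C` times as likely as the most fragile relay being light), then
`NoHeavyLowerTail` holds.  Proof: `lowerTail_le_sum_selection` (blob decomposition + Kozma–Nitzan Thm 8 per class) gives the
cumulative isolation lemma with constant `C`, and constants are free (`noHeavyLowerTail_of_cumulativeIsolationConst_allLevels`).
[this work] -/
theorem noHeavyLowerTail_of_portSelection (C : ℝ) (hC : 0 ≤ C)
    (hSEL : ∀ (n : ℕ) (w : Sym2 (Fin n) → unitInterval) (A : Finset (Fin n)) (o : Fin n) (j : ℕ),
      A.Nonempty → o ∉ A → ∃ c : Finset (Fin n) → Fin n,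
        (∀ V₀ : Finset (Fin n), o ∈ V₀ → Disjoint V₀ A → c V₀ ∈ A ∧
          ∀ v ∈ A, (∃ u ∈ V₀, w s(u, v) ≠ 0) →
            (Literature.Probability.LatticeModels.prodBernoulli w).real
                {ω : Literature.Probability.Percolation.BondConfig (Fin n) |
                  (A.filter fun z => ω ∈ Literature.Probability.Percolation.openConnIn ((↑V₀ : Set (Fin n))ᶜ) v z).card ≤ j} ≤
              (Literature.Probability.LatticeModels.prodBernoulli w).real
                {ω : Literature.Probability.Percolation.BondConfig (Fin n) |
                  (A.filter fun z => ω ∈ Literature.Probability.Percolation.openConnIn ((↑V₀ : Set (Fin n))ᶜ) (c V₀) z).card ≤ j}) ∧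
        ∃ a ∈ A,
          ∑ V₀ ∈ (Finset.univ : Finset (Finset (Fin n))).filter (fun V₀ => o ∈ V₀ ∧ Disjoint V₀ A),
            (Literature.Probability.LatticeModels.prodBernoulli w).real
              ({ω : Literature.Probability.Percolation.BondConfig (Fin n) |
                  1 ≤ (A.filter fun x => ω ∈ Literature.Probability.Percolation.openConn o x).card} ∩
                {ω : Literature.Probability.Percolation.BondConfig (Fin n) |
                  (A.filter fun x => ω ∈ Literature.Probability.Percolation.openConn (c V₀) x).card ≤ j} ∩
                {ω : Literature.Probability.Percolation.BondConfig (Fin n) |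
                  (∀ u ∈ V₀, ω ∈ Literature.Probability.Percolation.openConnIn (↑V₀ : Set (Fin n)) o u) ∧
                    ∀ u ∈ V₀, ∀ x, x ∉ V₀ → x ∉ A → s(u, x) ∉ ω}) ≤
          C * (Literature.Probability.LatticeModels.prodBernoulli w).real
              {ω : Literature.Probability.Percolation.BondConfig (Fin n) |
                (A.filter fun x => ω ∈ Literature.Probability.Percolation.openConn a x).card ≤ j}) :
    Summit.CriticalPhenomena.PercolationContinuityZ3.Theses.PercNearOneGluing.NoHeavyLowerTail := by
  refine noHeavyLowerTail_of_cumulativeIsolationConst_allLevels C hC fun n w A o j hA hoA => ?_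
  obtain ⟨c, hc, a, ha, hsum⟩ := hSEL n w A o j hA hoA
  exact ⟨a, ha, (lowerTail_le_sum_selection w A o j hoA c hc).trans hsum⟩

end Summit.CriticalPhenomena.PercolationContinuityZ3.Theorems
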